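import Summits.MatrixMultiplication.OmegaCensus.SmallFormats.MatMul226GF3Cap6Certificate
import Summits.MatrixMultiplication.OmegaCensus.SmallFormats.InvertiblePointNearDeltaLaw
import HarnessLib

/-!
# ω-census family (a): **`R_𝔽₃(⟨2,2,6⟩) = 21`** — no bilinear computation of `⟨2,2,6⟩` over `𝔽₃` has 20 products

Cell `pub-omega` (unit `pub-omega-tensor`, gen 36), topic `Summits/MatrixMultiplication/OmegaCensus` (sub-folder
`SmallFormats`). Framing (verbatim): lottery ticket; floor = certified bounds/negative ranges. HONEST FRAMING: an UNCONDITIONAL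
kernel theorem assembling two accepted halves: (i) tensor g35's conditional rung `Enum723.tensorRank_226_gf3_eq_of_cap6`
(p676682: the `𝔽₃` class-count system of `⟨2,2,6⟩@20` with invertible lines capped at `6` is EMPTY — a 185-node / 93-leaf
exact-LP branch-and-bound certificate checked by `linarith` — so `R_𝔽₃(⟨2,2,6⟩) = 21` IF every 20-term scheme has at least 14
nonvanishing X-forms at every invertible point), and (ii) tensor g36's NEAR REFINED δ-LAW
(`DeltaLaw.fourteen_le_card_filter_ne_226_20`, any field: a 20-term computation of `⟨2,2,6⟩` has no saturated and no near
invertible point, since `2·20 + 1 = 41 < 42 = 7·6`). The upper bound `21` is the tree's Hopcroft–Kerr scheme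
(`hopcroftKerr1971_tensorRank_matMulTensor_22n_le`). Window before this file: `[20, 21]` (`tensorRank_matMulTensor_22n_gf3_window`,
Alekseev–Nazarov floor `⌈36n/11⌉ = 20`). The value is a theorem: the exact bilinear complexity of `2 × 2` by `2 × 6` matrix
multiplication over `𝔽₃`; nothing here is a bound on `ω`.
-/

namespace Summit.MatrixMultiplication.OmegaCensus.SmallFormats.Enum723

open Literature.Computability.AlgebraicComplexity Matrix

/-- **`21 ≤ R_𝔽₃(⟨2,2,6⟩)`: no 20-term `𝔽₃`-bilinear computation of `⟨2,2,6⟩` exists.** -/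
theorem twentyone_le_tensorRank_226_gf3 : 21 ≤ tensorRank (matMulTensor (ZMod 3) 2 2 6) :=
  twentyone_le_tensorRank_226_gf3_of_cap6 fun β X₀ hX₀ =>
    DeltaLaw.fourteen_le_card_filter_ne_226_20 β (Fintype.card_fin 20) X₀ hX₀

/-- **`R_𝔽₃(⟨2,2,6⟩) = 21`.** The bilinear complexity (tensor rank) of `2 × 2` by `2 × 6` matrix multiplication over `𝔽₃` is
exactly `21 = ⌈7·6/2⌉` (three Strassens / Hopcroft–Kerr). -/
theorem tensorRank_226_gf3 : tensorRank (matMulTensor (ZMod 3) 2 2 6) = 21 :=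
  tensorRank_226_gf3_eq_of_cap6 fun β X₀ hX₀ =>
    DeltaLaw.fourteen_le_card_filter_ne_226_20 β (Fintype.card_fin 20) X₀ hX₀

end Summit.MatrixMultiplication.OmegaCensus.SmallFormats.Enum723
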